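import Summits.BirchSwinnertonDyer.BirchSwinnertonDyer.Theorems.PublishedInputsGreenbergLocalSurjectivityAtPCoinv
import HarnessLib

set_option linter.dupNamespace false -- `…BirchSwinnertonDyer.BirchSwinnertonDyer…` is the cell's nested layout (D-0017)
set_option autoImplicit false

/-!
# Route `ByReductionTypeAtTwo`, crux `MultUpperHalfAtTwo` (item stmt-BirchSwinnertonDyer-19922), TOWER road, Greenberg LNM 1716
# §4 p. 108 «for `v ∣ p`» at a MULTIPLICATIVE place, part 2 — `(E(K_{∞,η}) ⊗ ℚ_p/ℤ_p)_{Γ_η} = 0` from `H²(K_v, C) = 0` and a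
# Coates–Greenberg input that holds only UP TO A BOUNDED MULTIPLE `n₀`

HONEST FRAMING (cell `bsd-2adic`, run/shared/lean/pub/bsd-2adic/, seat `bsd-2adic-tower-1` GEN 29, HUMAN RULINGS
D-0036 / D-0054 / D-0074): TOOL theorems only (no definition, no named fact, no `sorry`); closes nothing by itself;
nothing booked; BSD is not proved by any of this.

bsd-inputs-k4-p1's `InputsGreenbergLocalAtP.coinvInput_of_mem_ker` / `coinvInput_of_formalH2_of_coatesGreenberg`
(`PublishedInputsGreenbergLocalSurjectivityAtPCoinv`) derive the element-wise hypothesis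

  (H²) `∀ a ∈ M, ∀ k, ∃ j, m R ∈ M, t ∈ E(K̄_v)[p^∞]: p^j a = (g − 1) m + p^{k+j} R + t`, `M = E(K̄_v)^N`,

of the generic reduction `Greenberg1999.exists_primary_resOfLe_eq_of_forall_conjH1_eq_of_coinv` (Greenberg's p. 108 local
surjectivity at ANY place) from a `Γ_{K_v}`-stable, `p`-divisible, co-torsion subgroup `E₁`, `H²(Γ_{K_v}, C) = 0` for
`C = E₁[p^∞]`, and the Coates–Greenberg vanishing «every `E₁`-valued continuous cocycle of `N` is `∂e` with `e ∈ E₁`». At a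
MULTIPLICATIVE place the Tate side (`E₁ = Ψ(units)`, `C = Ψ(μ_{p^∞}) ≅ μ_{p^∞}(χ)`) delivers that vanishing only for
`C`-valued cocycles and only UP TO the factor `2` of the quadratic character `χ` (part 1,
`MultLocSurj.exists_two_nsmul_eq_coboundary_of_values_in_roots`). THIS FILE re-runs k4-p1's core with the input weakened
accordingly — which is all the core ever used (it applies «`hCG`» to ONE `C`-valued cocycle, and never uses `e ∈ E₁`):

* `coinvInput_of_mem_of_nsmulCoboundary` — THE CORE in subgroup currency (`E₁ ≤ E(K̄_v)`): for a `ℤ_p`-extension `κE` of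
  `K_v` with kernel `N` and topological generator `g`, `H²(Γ_{K_v}, C) = 0` (`hH2`), and «`n₀ • ψ = ∂e` for every continuous
  `1`-cocycle `ψ` of `N` with values in `C`» (`hCG`): for every `N`-fixed `a ∈ E₁` and every `k` there are `j`, `N`-fixed
  `m, R` and a `p`-power torsion `t` with `p^j (n₀ • a) = (g m − m) + p^{k+j} R + t`. Proof = k4-p1's (Kummer cocycle of
  `b`, `p^k b = a`; Hochschild–Serre `exists_conjMap_sub_eq_of_resSubgroup_two_injective` with `cd_p(Γ/N) = 1`; then
  «`hCG`» and the unwinding), every identity multiplied by `n₀`.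
* `coinvInput_of_H2_of_nsmulCoboundary` — (H²) for EVERY `N`-fixed `a` when moreover every point has a positive multiple
  in `E₁` (`htor`) and `0 < n₀`: write `n₀ n = p^S U` with `p ∤ U`, run the core at depth `k + S`, descend by k4-p1's
  `coinvInput_of_nsmul_not_dvd` / `coinvInput_of_pow_nsmul`.

References: [GreenbergLNM1716] §2 pp. 70–76, §4 p. 108; [CoatesGreenberg1996] §3 (the input weakened here);
[NeukirchSchmidtWingberg2008] (2.4.1); [SerreLocalFields1979] VII §6, X §1.
-/

noncomputable section

open scoped Classical NNReal

universe u

namespace Summit.BirchSwinnertonDyer.BirchSwinnertonDyer.Theorems.MultLocSurj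

open CategoryTheory NumberField IsDedekindDomain Field _root_.TopRep _root_.ContinuousCohomology WeierstrassCurve
  Literature.NumberTheory.GaloisRepresentations Literature.NumberTheory.EllipticCurves
  Literature.NumberTheory.EllipticCurves.ZpExtension
  Summit.BirchSwinnertonDyer.BirchSwinnertonDyer.Theorems.InputsGreenbergLocalAtP

variable {K : Type u} [Field K] [NumberField K] (v : HeightOneSpectrum (𝓞 K)) (W : WeierstrassCurve K)
  {p : ℕ} [hp : Fact p.Prime]

/-! ## §1 The core: (H²) on `M ∩ E₁`, up to `n₀`, from `H²(K_v, C) = 0` and «`n₀ ψ = ∂e`» -/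

set_option maxHeartbeats 3200000 in
/-- **(H²) for `a ∈ E(K̄_v)^N ∩ E₁`, up to the multiple `n₀`.** Setting: `K` a number field, `v` a finite place, `W/K` a
Weierstrass curve, `κE` a `ℤ_p`-extension of `K_v` with kernel `N` and topological generator `g`; `E₁ ≤ E(K̄_v)` a
`Γ_{K_v}`-stable (`hstab`) and `p`-divisible (`hdiv₁`) subgroup; `C = E₁ ∩ E(K̄_v)[p^∞]` (`hC`) with a continuous
representation `ρ` of `Γ_{K_v}` acting as Galois (`hρ`) and **`H²(Γ_{K_v}, C) = 0`** (`hH2`); and, in place of the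
Coates–Greenberg vanishing, **`n₀ • ψ = ∂e` for every continuous `C`-valued `1`-cocycle `ψ` of `N`** (`hCG`). Then for every
`a ∈ E₁` fixed by `N` and every `k` there are `j`, `N`-fixed `m, R` and a `p`-power torsion `t` with
`p^j (n₀ • a) = (g m − m) + p^{k+j} R + t`. Proof: the Kummer cocycle `s = ∂b` of `a` (`p^k b = a`, `b ∈ E₁`) is a class of
`H¹(N, C)`; by Hochschild–Serre with `cd_p(Γ_{K_v}/N) = 1` and `hH2` (`exists_conjMap_sub_eq_of_resSubgroup_two_injective`)
`[s] = g·[ψ] − [ψ]`; by `hCG` `n₀ψ = ∂e`; unwinding, `n₀ b + n₀ c₀ − (g − 1) e ∈ M`, and a large power of `p` gives the claim.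
k4-p1's `coinvInput_of_mem_ker` with its input «`hCG`» weakened (adapted proof).
[cite: GreenbergLNM1716, §2 pp. 70–76 and §4 p. 108] [cite: NeukirchSchmidtWingberg2008, (2.4.1)] -/
theorem coinvInput_of_mem_of_nsmulCoboundary (κE : ZpExtension (v.adicCompletion K) p)
    {g : absoluteGaloisGroup (v.adicCompletion K)} (hγ : κE.IsTopGenerator g)
    (E₁ : AddSubgroup (localPoints W (v.adicCompletion K)))
    (hstab : ∀ (σ : absoluteGaloisGroup (v.adicCompletion K)) (Q : localPoints W (v.adicCompletion K)),
      Q ∈ E₁ → σ • Q ∈ E₁)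
    (hdiv₁ : ∀ a ∈ E₁, ∃ b ∈ E₁, p • b = a)
    (C : AddSubgroup (localPoints W (v.adicCompletion K)))
    (hC : ∀ a, a ∈ C ↔ a ∈ E₁ ∧ ∃ e : ℕ, p ^ e • a = 0)
    (ρ : ContinuousRep (absoluteGaloisGroup (v.adicCompletion K)) ℤ C)
    (hρ : ∀ (σ : absoluteGaloisGroup (v.adicCompletion K)) (c : C),
      ((ρ σ c : C) : localPoints W (v.adicCompletion K)) = σ • (c : localPoints W (v.adicCompletion K)))
    (hH2 : Subsingleton (continuousCohomology 2 ρ.toTopRep))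
    (n₀ : ℕ)
    (hCG : ∀ ψ : contOneCocycles (subgroupRep ρ.toTopRep κE.kerSubgroup),
      ∃ e : localPoints W (v.adicCompletion K), ∀ τ : κE.kerSubgroup,
        n₀ • ((ψ.1 τ : C) : localPoints W (v.adicCompletion K)) =
          (τ : absoluteGaloisGroup (v.adicCompletion K)) • e - e)
    (a : localPoints W (v.adicCompletion K)) (ha0 : a ∈ E₁) (ha : ∀ τ ∈ κE.kerSubgroup, τ • a = a) (k : ℕ) :
    ∃ (j : ℕ) (m R t : localPoints W (v.adicCompletion K)),
      (∀ τ ∈ κE.kerSubgroup, τ • m = m) ∧ (∀ τ ∈ κE.kerSubgroup, τ • R = R) ∧ (∃ e : ℕ, p ^ e • t = 0) ∧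
      p ^ j • (n₀ • a) = (g • m - m) + p ^ (k + j) • R + t := by
  -- adapted from `InputsGreenbergLocalAtP.coinvInput_of_mem_ker` (bsd-inputs-k4-p1); the changes: `E₁` as a subgroup,
  -- and the Coates–Greenberg input used up to the multiple `n₀` (every identity of the unwinding multiplied by `n₀`)
  -- notation and instances
  let E := v.adicCompletion K
  let Pt : Type u := localPoints W E
  let Γ := absoluteGaloisGroup E
  let N : Subgroup Γ := κE.kerSubgroup
  haveI : CompactSpace Γ := absoluteGaloisGroup_compactSpace E
  haveI : T2Space Γ := krullTopology_t2
  haveI hNc : IsClosed ((κE.kerSubgroup : Subgroup Γ) : Set Γ) := κE.isClosed_kerSubgroup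
  haveI : CompactSpace κE.kerSubgroup := isCompact_iff_compactSpace.mp hNc.isCompact
  have galois_smul_nsmul : ∀ (τ : Γ) (n : ℕ) (P : Pt), τ • (n • P) = n • (τ • P) :=
    fun τ n P ↦ map_nsmul (DistribSMul.toAddMonoidHom Pt τ) n P
  have hprim : IsPrimaryTorsion p C := fun c ↦ by
    obtain ⟨-, e, he⟩ := (hC c).mp c.2
    exact ⟨e, Subtype.ext (by rw [AddSubgroupClass.coe_nsmul, he, ZeroMemClass.coe_zero])⟩
  -- iterated `p`-divisibility of `E₁`
  have hdivpow : ∀ (i : ℕ) (x : Pt), x ∈ E₁ → ∃ y : Pt, y ∈ E₁ ∧ p ^ i • y = x := by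
    intro i
    induction i with
    | zero => exact fun x hx ↦ ⟨x, hx, by rw [pow_zero, one_smul]⟩
    | succ i ih =>
      intro x hx
      obtain ⟨y, hy, rfl⟩ := hdiv₁ x hx
      obtain ⟨z, hz, rfl⟩ := ih y hy
      exact ⟨z, hz, by rw [pow_succ, mul_comm, mul_smul]⟩
  -- `b ∈ E₁` with `p^k b = a`; the Kummer cocycle `s(τ) = τ b − b` with values in `C`
  obtain ⟨b, hb0, hba⟩ := hdivpow k a ha0
  have hsmem : ∀ τ : κE.kerSubgroup, (τ : Γ) • b - b ∈ C := fun τ ↦ by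
    refine (hC _).mpr ⟨E₁.sub_mem (hstab _ b hb0) hb0, k, ?_⟩
    rw [smul_sub, ← galois_smul_nsmul, hba, ha τ τ.2, sub_self]
  have hscont : Continuous fun τ : κE.kerSubgroup ↦ (⟨(τ : Γ) • b - b, hsmem τ⟩ : C) :=
    ((continuous_of_discreteTopology (f := fun q : Pt ↦ q - b)).comp
      ((continuous_smul_localPoints W E b).comp continuous_subtype_val)).subtype_mk _
  have hρN : ∀ (τ : κE.kerSubgroup) (c : C),
      (((subgroupRep ρ.toTopRep κE.kerSubgroup).ρ τ c : C) : Pt) = (τ : Γ) • (c : Pt) := fun τ c ↦ hρ τ c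
  let s : contOneCocycles (subgroupRep ρ.toTopRep κE.kerSubgroup) :=
    ⟨⟨fun τ ↦ ⟨(τ : Γ) • b - b, hsmem τ⟩, hscont⟩, fun σ τ ↦ by
      apply Subtype.ext
      rw [AddSubgroup.coe_add, hρN]
      change ((σ : Γ) * (τ : Γ)) • b - b = ((σ : Γ) • b - b) + (σ : Γ) • ((τ : Γ) • b - b)
      rw [mul_smul, smul_sub]
      abel⟩
  have hs : ∀ τ : κE.kerSubgroup, ((s.1 τ : C) : Pt) = (τ : Γ) • b - b := fun _ ↦ rfl
  -- Hochschild–Serre: `[s] = g·[ψ] − [ψ]` in `H¹(N, C)`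
  have hinj : ∀ x : continuousCohomology 2 ρ.toTopRep, resSubgroup ρ.toTopRep κE.kerSubgroup 2 x = 0 → x = 0 :=
    fun x _ ↦ Subsingleton.elim _ _
  obtain ⟨tc, htc⟩ := exists_conjMap_sub_eq_of_resSubgroup_two_injective κE.toContinuousMonoidHom κE.kerSubgroup ρ
    κE.surjective (fun _ ↦ ZpExtension.mem_kerSubgroup) hγ (groupCdLE_one_quotient_kerSubgroup κE) hprim hinj
    (oneCocycleClass _ s)
  obtain ⟨ψ, rfl⟩ := oneCocycleClass_surjective _ tc
  rw [conjMap_oneCocycleClass, ← oneCocycleClass_sub, ← sub_eq_zero, ← oneCocycleClass_sub,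
    oneCocycleClass_eq_zero_iff] at htc
  obtain ⟨c₀, hc₀⟩ := htc
  have hc₀' : ∀ τ : κE.kerSubgroup,
      g • (((ψ.1 (subgroupConj κE.kerSubgroup g τ) : C) : Pt)) - ((ψ.1 τ : C) : Pt) - ((τ : Γ) • b - b) =
        (τ : Γ) • (c₀ : Pt) - c₀ := by
    intro τ
    have h := congrArg (fun x : C ↦ (x : Pt)) (hc₀ τ)
    simp only [ContinuousMap.sub_apply, AddSubgroupClass.coe_sub] at h
    rw [hρN, hs] at h
    rw [← hρ]
    exact h
  -- a uniform exponent killing `ψ` and `c₀`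
  obtain ⟨Nψ, hNψ⟩ := exists_pow_smul_apply_eq_zero (p := p) ψ.1 (fun τ ↦ hprim _)
  obtain ⟨e₀, he₀⟩ := hprim c₀
  -- the weakened Coates–Greenberg input: `n₀ ψ = ∂e`
  obtain ⟨e, he⟩ := hCG ψ
  -- every identity multiplied by `n₀`: `b' = n₀ b`, `c₀' = n₀ c₀`
  have hconj_smul : ∀ τ : κE.kerSubgroup, g • (((subgroupConj κE.kerSubgroup g τ : κE.kerSubgroup) : Γ) • e) =
      (τ : Γ) • g • e := fun τ ↦ by
    rw [subgroupConj_apply_coe, ← mul_smul, ← mul_smul, ← mul_assoc, ← mul_assoc, mul_inv_cancel, one_mul]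
  have hc₀n : ∀ τ : κE.kerSubgroup,
      g • ((((subgroupConj κE.kerSubgroup g τ : κE.kerSubgroup) : Γ) • e) - e) - ((τ : Γ) • e - e) -
          ((τ : Γ) • (n₀ • b) - n₀ • b) = (τ : Γ) • (n₀ • (c₀ : Pt)) - n₀ • (c₀ : Pt) := by
    intro τ
    have h := congrArg (fun x : Pt ↦ n₀ • x) (hc₀' τ)
    simp only [smul_sub, ← galois_smul_nsmul] at h
    rw [he, he] at h
    rw [galois_smul_nsmul, galois_smul_nsmul]
    rw [galois_smul_nsmul (τ : Γ) n₀ b, galois_smul_nsmul (τ : Γ) n₀ (c₀ : Pt)] at h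
    exact h
  -- `R' = n₀ b + n₀ c₀ − (g e − e)` is fixed by `N`
  have hR' : ∀ τ ∈ κE.kerSubgroup,
      τ • (n₀ • b + n₀ • (c₀ : Pt) - (g • e - e)) = n₀ • b + n₀ • (c₀ : Pt) - (g • e - e) := by
    intro τ hτ
    have h := hc₀n ⟨τ, hτ⟩
    rw [smul_sub g, hconj_smul] at h
    rw [← sub_eq_zero]
    rw [← sub_eq_zero] at h
    rw [smul_sub τ, smul_add τ, smul_sub τ]
    change τ • g • e - g • e - (τ • e - e) - (τ • (n₀ • b) - n₀ • b) - (τ • (n₀ • (c₀ : Pt)) - n₀ • (c₀ : Pt)) = 0 at h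
    calc τ • (n₀ • b) + τ • (n₀ • (c₀ : Pt)) - (τ • g • e - τ • e) - (n₀ • b + n₀ • (c₀ : Pt) - (g • e - e))
        = -(τ • g • e - g • e - (τ • e - e) - (τ • (n₀ • b) - n₀ • b) - (τ • (n₀ • (c₀ : Pt)) - n₀ • (c₀ : Pt))) := by
          abel
      _ = 0 := by rw [h, neg_zero]
  -- `m = p^K e` is fixed by `N` for `K = k + (Nψ + e₀)`
  have hm : ∀ τ ∈ κE.kerSubgroup, τ • ((p ^ (k + (Nψ + e₀))) • e) = (p ^ (k + (Nψ + e₀))) • e := by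
    intro τ hτ
    have h1 : p ^ Nψ • (τ • e - e) = 0 := by
      have h := congrArg (fun x : C ↦ n₀ • (x : Pt)) (hNψ ⟨τ, hτ⟩)
      simp only [AddSubgroupClass.coe_nsmul, ZeroMemClass.coe_zero, smul_zero] at h
      rw [smul_comm, he] at h
      exact h
    rw [galois_smul_nsmul, ← sub_eq_zero, ← smul_sub, show k + (Nψ + e₀) = (k + e₀) + Nψ by ring, pow_add,
      mul_smul, h1, smul_zero]
  refine ⟨Nψ + e₀, (p ^ (k + (Nψ + e₀))) • e, n₀ • b + n₀ • (c₀ : Pt) - (g • e - e), 0, hm, hR', ⟨0, smul_zero _⟩, ?_⟩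
  -- multiply `R'` by `p^(k + Nψ + e₀)`
  have h1 : p ^ (k + (Nψ + e₀)) • (n₀ • b) = p ^ (Nψ + e₀) • (n₀ • a) := by
    rw [smul_comm (p ^ (k + (Nψ + e₀))) n₀ b, pow_add, mul_comm, mul_smul, hba, smul_comm]
  have h2 : p ^ (k + (Nψ + e₀)) • (n₀ • (c₀ : Pt)) = 0 := by
    have h3 : p ^ e₀ • (c₀ : Pt) = 0 := by
      rw [← AddSubgroupClass.coe_nsmul, he₀, ZeroMemClass.coe_zero]
    rw [smul_comm, show k + (Nψ + e₀) = (k + Nψ) + e₀ by ring, pow_add, mul_smul, h3, smul_zero, smul_zero]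
  rw [add_zero, smul_sub (p ^ (k + (Nψ + e₀))), smul_add (p ^ (k + (Nψ + e₀))), h1, h2, add_zero,
    smul_sub (p ^ (k + (Nψ + e₀))), galois_smul_nsmul]
  abel

/-! ## §2 (H²) on all of `M = E(K̄_v)^N` -/

set_option maxHeartbeats 800000 in
/-- **`(E(K_{∞,η}) ⊗ ℚ_p/ℤ_p)_{Γ_η} = 0`, element-wise, from `H²(K_v, C) = 0` and «`n₀ ψ = ∂e`»** — the hypothesis (H²) of
`Greenberg1999.exists_primary_resOfLe_eq_of_forall_conjH1_eq_of_coinv`, for the kernel `N` and a topological generator `g` of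
a `ℤ_p`-extension `κE` of `K_v`, from: a `Γ_{K_v}`-stable, `p`-divisible subgroup `E₁ ≤ E(K̄_v)` in which every point has a
positive multiple (`htor`), `H²(Γ_{K_v}, C) = 0` for `C = E₁ ∩ E(K̄_v)[p^∞]`, and «`n₀ ψ = ∂e` for every continuous `C`-valued
`1`-cocycle of `N`» with `0 < n₀`. For every `N`-fixed `a` and every `k` there are `j`, `N`-fixed `m, R` and a `p`-power
torsion `t` with `p^j a = (g m − m) + p^{k+j} R + t`: writing `n₀ n = p^S U` (`p ∤ U`, `n a ∈ E₁`), the core at depth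
`k + S` and k4-p1's descents `coinvInput_of_nsmul_not_dvd`, `coinvInput_of_pow_nsmul`.
[cite: GreenbergLNM1716, §2 pp. 70–76 and §4 p. 108] -/
theorem coinvInput_of_H2_of_nsmulCoboundary (κE : ZpExtension (v.adicCompletion K) p)
    {g : absoluteGaloisGroup (v.adicCompletion K)} (hγ : κE.IsTopGenerator g)
    (E₁ : AddSubgroup (localPoints W (v.adicCompletion K)))
    (hstab : ∀ (σ : absoluteGaloisGroup (v.adicCompletion K)) (Q : localPoints W (v.adicCompletion K)),
      Q ∈ E₁ → σ • Q ∈ E₁)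
    (hdiv₁ : ∀ a ∈ E₁, ∃ b ∈ E₁, p • b = a)
    (htor : ∀ P : localPoints W (v.adicCompletion K), ∃ n : ℕ, 0 < n ∧ n • P ∈ E₁)
    (C : AddSubgroup (localPoints W (v.adicCompletion K)))
    (hC : ∀ a, a ∈ C ↔ a ∈ E₁ ∧ ∃ e : ℕ, p ^ e • a = 0)
    (ρ : ContinuousRep (absoluteGaloisGroup (v.adicCompletion K)) ℤ C)
    (hρ : ∀ (σ : absoluteGaloisGroup (v.adicCompletion K)) (c : C),
      ((ρ σ c : C) : localPoints W (v.adicCompletion K)) = σ • (c : localPoints W (v.adicCompletion K)))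
    (hH2 : Subsingleton (continuousCohomology 2 ρ.toTopRep))
    {n₀ : ℕ} (hn₀ : 0 < n₀)
    (hCG : ∀ ψ : contOneCocycles (subgroupRep ρ.toTopRep κE.kerSubgroup),
      ∃ e : localPoints W (v.adicCompletion K), ∀ τ : κE.kerSubgroup,
        n₀ • ((ψ.1 τ : C) : localPoints W (v.adicCompletion K)) =
          (τ : absoluteGaloisGroup (v.adicCompletion K)) • e - e)
    (a : localPoints W (v.adicCompletion K)) (ha : ∀ τ ∈ κE.kerSubgroup, τ • a = a) (k : ℕ) :
    ∃ (j : ℕ) (m R t : localPoints W (v.adicCompletion K)),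
      (∀ τ ∈ κE.kerSubgroup, τ • m = m) ∧ (∀ τ ∈ κE.kerSubgroup, τ • R = R) ∧ (∃ e : ℕ, p ^ e • t = 0) ∧
      p ^ j • a = (g • m - m) + p ^ (k + j) • R + t := by
  have galois_smul_nsmul : ∀ (τ : absoluteGaloisGroup (v.adicCompletion K)) (n : ℕ)
      (P : localPoints W (v.adicCompletion K)), τ • (n • P) = n • (τ • P) :=
    fun τ n P ↦ map_nsmul (DistribSMul.toAddMonoidHom (localPoints W (v.adicCompletion K)) τ) n P
  -- a positive multiple `n a ∈ E₁`; `n₀ n = p^S U` with `p ∤ U`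
  obtain ⟨n, hn, hna⟩ := htor a
  obtain ⟨S, U, hU, hSU⟩ := Nat.exists_eq_pow_mul_and_not_dvd (Nat.mul_pos hn₀ hn).ne' p hp.out.ne_one
  have hfix : ∀ τ ∈ κE.kerSubgroup, τ • (n • a) = n • a := fun τ hτ ↦ by
    rw [galois_smul_nsmul, ha τ hτ]
  -- the core for `n • a` at depth `k + S`
  have hcore := coinvInput_of_mem_of_nsmulCoboundary v W κE hγ E₁ hstab hdiv₁ C hC ρ hρ hH2 n₀ hCG (n • a) hna hfix
    (k + S)
  have hcore' : ∃ (j : ℕ) (m R t : localPoints W (v.adicCompletion K)),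
      (∀ τ ∈ κE.kerSubgroup, τ • m = m) ∧ (∀ τ ∈ κE.kerSubgroup, τ • R = R) ∧ (∃ e : ℕ, p ^ e • t = 0) ∧
      p ^ j • (U • (p ^ S • a)) = (g • m - m) + p ^ (k + S + j) • R + t := by
    obtain ⟨j, m, R, t, hm, hR, ht, heq⟩ := hcore
    refine ⟨j, m, R, t, hm, hR, ht, ?_⟩
    rw [← mul_smul U, mul_comm U, ← hSU, mul_smul, ← heq]
  exact coinvInput_of_pow_nsmul v W κE.kerSubgroup g a k S
    (coinvInput_of_nsmul_not_dvd v W κE.kerSubgroup g (p ^ S • a) (k + S) hU hcore'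
      (fun τ hτ ↦ by rw [galois_smul_nsmul, ha τ hτ]))

end Summit.BirchSwinnertonDyer.BirchSwinnertonDyer.Theorems.MultLocSurj

end
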